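import Summits.Ventures.QEDPrecision.BubbleChains.Consequences
import Summits.Ventures.QEDPrecision.KallenSabry.RIBPControls

/-!
# The typed eighth-order subgroups I(a), I(b) (Kinoshita–Nio 2006) against the cell's kernel results: I(a) = the PROVED triple-bubble closed form (∋ Laporta 2017 set 17), I(b) = `2∫(1−x)K(x)(∫Φ)` (the control `C₈` in elementary form)

HONEST FRAMING: independent recomputation; certified where stated, statistical where stated; no new-physics claim.

Cell `pub-qed`, unit `pub-qed-lit` (venture `QEDPrecision`). The Literature file
`Jegerlehner2017/SpectralFunctionInsertions.lean` now types the EIGHTH-order subgroups of Kinoshita–Nio,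
Phys. Rev. D 73 (2006) 013003 §3 [cite: KinoshitaNio2006Alpha4, §3]: `groupIaEightRep = seqInsertion ρ₂ 3 1`
("three Π₂'s in a second-order vertex", one diagram) and `groupIbEightRep = 2∫₀¹(1−x)(∫ρ₂/W)(∫ρ₄/W)` ("a Π₂ and a
Π₄ in a second-order vertex", six diagrams) in Jegerlehner's representation [cite: Jegerlehner2017, eqs. (3.159)–(3.161)].
This theorems-only file records what the tree already PROVES about them:
* `groupIaEightRep_eq_closedForm : groupIaEightRep = a8GroupIaClosedForm` — the typed subgroup I(a) equals the
  printed closed form `151849/40824 − 2π⁴/45 + 32ζ(3)/63` (Solovtsova–Lashkevich–Sidorov 2019; Literature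
  `SolovtsovaLashkevichKaptari2024/UniversalBubbleChains.lean`) by the BubbleChains kernel theorem `vpChain_three_one`;
  hence `groupIaEightRep_enclosure` (±4e-23) and `groupIaEightRep_laporta2017_set17`: Laporta's 40-digit set-17
  value lies within 7e-23 of it (transported from `BubbleChains/Consequences.lean`);
* `groupIbEightRep_eq_integral_phiIBP : groupIbEightRep = 2∫₀¹(1−x)K(x)(∫₀¹Φ(t,x)dt)dx` — subgroup I(b), i.e. the
  eighth-order CONTROL `C₈` of the Set I(b)/I(c) certificate (`certs/SetIbIc`), in the elementary (R-IBP) form the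
  certificate integrates (quad's kernel theorem `integral_rho4_div_wt_eq_integral_phiIBP` via
  `KallenSabry/RIBPControls.lean`); `K` the closed one-loop kernel of `integral_rho2_div_wt_eq`.
No value of `groupIbEightRep` is asserted (its comparison with Laporta's set 18 is the certificate's interval
statement, outside Lean). No definitions, no `sorry`, zero `kit`; axioms standard.
-/

noncomputable section

open Real Set MeasureTheory intervalIntegral

namespace Summit.Ventures.QEDPrecision.KallenSabry

open Literature.MathematicalPhysics.QuantumFieldTheory.Jegerlehner2017 (rho2 rho4 wt seqInsertion vpChain
  groupIaEightRep groupIbEightRep groupIaEightRep_eq_vpChain)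
open Literature.MathematicalPhysics.QuantumFieldTheory.SolovtsovaLashkevichKaptari2024 (a8GroupIaClosedForm)
open Summit.Ventures.QEDPrecision.Integrands (phiIBP)
open Summit.Ventures.QEDPrecision.BubbleChains (vpChain_three_one vpChain_three_one_enclosure
  vpChain_three_one_laporta2017_set17)

/-- **Eighth-order subgroup I(a) = the printed triple-bubble closed form**:
`groupIaEightRep = 151849/40824 − 2π⁴/45 + 32ζ(3)/63` (`a8GroupIaClosedForm`), by `vpChain_three_one`.
[cite: KinoshitaNio2006Alpha4, §3 (Subgroup I(a))] -/
theorem groupIaEightRep_eq_closedForm : groupIaEightRep = a8GroupIaClosedForm := by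
  rw [groupIaEightRep_eq_vpChain, vpChain_three_one]

/-- Kernel enclosure of the typed subgroup I(a): `|groupIaEightRep − 0.000 876 865 858 889 990 697 9| ≤ 4e-23`.
[cite: KinoshitaNio2006Alpha4, §3 (Subgroup I(a))] -/
theorem groupIaEightRep_enclosure :
    |groupIaEightRep - 0.0008768658588899906979| ≤ (4e-23 : ℝ) := by
  rw [groupIaEightRep_eq_vpChain]; exact vpChain_three_one_enclosure

/-- Laporta's 2017 set-17 value (40 printed digits) lies within `7e-23` of the typed subgroup I(a) (the paper's
"analytic result 0.000 876 865…" to all its digits). [cite: KinoshitaNio2006Alpha4, §3 (Subgroup I(a))]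
[cite: Laporta2017, Table 2] -/
theorem groupIaEightRep_laporta2017_set17 :
    |groupIaEightRep - 0.000876865858889990697913748939713726165| ≤ (7e-23 : ℝ) := by
  rw [groupIaEightRep_eq_vpChain]; exact vpChain_three_one_laporta2017_set17

/-- **Eighth-order subgroup I(b) (the control `C₈`) in elementary form**:
`groupIbEightRep = 2 ∫₀¹ (1−x)(4/(3x²) − 4/(3x) − 5/9 + (x³ − 6x + 4)/(3x³) ln(1−x)) (∫₀¹ Φ(t,x) dt) dx`, `Φ = phiIBP`
(quad's (R-IBP) kernel theorem). [cite: KinoshitaNio2006Alpha4, §3 (Subgroup I(b))] -/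
theorem groupIbEightRep_eq_integral_phiIBP :
    groupIbEightRep = 2 * ∫ x in (0:ℝ)..1, (1 - x) *
      (4 / (3 * x ^ 2) - 4 / (3 * x) - 5 / 9 + (x ^ 3 - 6 * x + 4) / (3 * x ^ 3) * log (1 - x))
        * ∫ t in (0:ℝ)..1, phiIBP x t := by
  unfold groupIbEightRep
  rw [integral_rho2_rho4_eq_integral_phiIBP]

end Summit.Ventures.QEDPrecision.KallenSabry

end
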